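import Literature.NumberTheory.Automorphic.AdicCompletionLocalField
import Literature.NumberTheory.GaloisCohomology.PoitouTateSha
import Literature.NumberTheory.GaloisCohomology.ShaOneMuRat
import Literature.NumberTheory.GaloisRepresentations.TateH2VanishingGlobalAssembly
import Literature.NumberTheory.GaloisRepresentations.TateH2VanishingArchimedean
import Literature.NumberTheory.GaloisRepresentations.TateLocalH2Vanishing
import Literature.NumberTheory.GaloisRepresentations.TateH2VanishingReduction
import HarnessLib

/-!
# Tate's theorem `H²(G_ℚ, ℚ/ℤ) = 0` and the lifting of projective representations of `G_ℚ`,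
# from Poitou–Tate duality (Serre, Durham 1977, §6.1 Thm. 4 and Corollary; Harari Cor. 18.17)

Sibling proof file of `TateProjectiveLifting.lean` (theorems only).  Assembly of the proof of the
named fact `Tate_projectiveLifting` (Serre, *Modular forms of weight one and Galois
representations*, §6.1, Corollary to Theorem 4 (Tate): every projective representation of `G_ℚ`
with open kernel, coefficients in an algebraically closed field with the discrete topology, has a
continuous lifting) modulo ONE named fact of the tree, the Poitou–Tate duality of the
Tate–Shafarevich groups `Ш¹(ℚ, μ_m)` and `Ш²(ℚ, ℤ/m)` (`poitouTate_sha_zmod_mu ℚ`,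
`Literature/NumberTheory/GaloisCohomology/PoitouTateSha.lean`; Harari Thm. 17.13 (b) with
Lemma 17.8).  The route is Tate's original one (Serre, §6.5: "Tate first announced (6.5.1) … as a
consequence of deeper … duality theorems") in the form of Harari's proof of Thm. 18.15 /
Cor. 18.17 (`H³(k, ℤ) = H²(k, ℚ/ℤ) = 0`):

* `twoCocycle_addCircle_prime_split_rat_of_poitouTate` — **`H²(G_ℚ, ℚ_p/ℤ_p) = 0`** (cochain form
  `(H_p)(Γ_ℚ)`) for every prime `p`: `twoCocycle_addCircle_prime_split_of_localGlobal`
  (`TateH2VanishingGlobalAssembly.lean`, the passage to the limit) fed with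
  (i) `Ш²(ℚ, ℤ/pⁿ) = 0` — the fact's duality with `Ш¹(ℚ, μ_{pⁿ})`, which vanishes
  (`sha_mu_rat_eq_bot`, `ShaOneMuRat.lean`: an everywhere-local `pⁿ`-th power in `ℚ` is a `pⁿ`-th
  power), (ii) the finiteness of the support of a class of `H²(ℚ, ℤ/p)` (the fact, Harari
  Lemma 17.8), (iii) Tate's local theorems at `ℚ_ℓ` (`twoCocycle_addCircle_prime_split_localField`,
  `TateLocalH2Vanishing.lean`, local class field theory) and at `ℝ`
  (`TateH2VanishingArchimedean.lean`);
* `twoCocycle_addCircle_split_rat_of_poitouTate` — **Tate's theorem `H²(G_ℚ, ℚ/ℤ) = 0` in cochain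
  form** (`twoCocycle_addCircle_split_of_forall_prime`, Serre §6.5 (a));
* `Tate_projectiveLifting_of_poitouTate` — **`Tate_projectiveLifting`** from it
  (`Tate_projectiveLifting_of_H2_addCircle`, Serre §6.1 "Theorem 4 ⟹ Corollary").

## References

* J.-P. Serre, *Modular forms of weight one and Galois representations*, in: Algebraic Number
  Fields (Durham 1975), Academic Press 1977, §6.1 Thm. 4 (Tate) and Corollary, §6.5.
  [`SerreDurham1977`]
* D. Harari, *Galois Cohomology and Class Field Theory* (2020), Thm. 17.13 (b), Lemma 17.8,
  Thm. 18.15, Cor. 18.17. [Harari2020]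
* J. Tate, *Duality theorems in Galois cohomology over number fields*, Proc. ICM 1962.
  [Tate1963DualityICM]
-/

noncomputable section

open Function Field NumberField IsDedekindDomain

namespace Literature.NumberTheory.GaloisRepresentations

open Literature.NumberTheory.GaloisCohomology

section Rat

/-- **`H²(G_ℚ, ℚ_p/ℤ_p) = 0`, cochain form, from the Poitou–Tate fact** (`p` prime): every locally
constant `p`-torsion `2`-cocycle `Γ_ℚ × Γ_ℚ → ℚ/ℤ` is the coboundary of a locally constant
cochain.  Inputs: `Ш²(ℚ, ℤ/pⁿ) = 0` (duality with `Ш¹(ℚ, μ_{pⁿ}) = 0`), finiteness of the support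
of `H²`-classes (the fact), Tate's local theorems at all places (proved in the tree).
[cite: SerreDurham1977, §6.1 Thm. 4 and §6.5] [cite: Harari2020, Thm. 18.15 (proof), Cor. 18.12] -/
theorem twoCocycle_addCircle_prime_split_rat_of_poitouTate (h : poitouTate_sha_zmod_mu ℚ)
    {p : ℕ} (hp : p.Prime)
    (g : absoluteGaloisGroup ℚ → absoluteGaloisGroup ℚ → AddCircle (1 : ℚ))
    (hg : IsLocallyConstant (Function.uncurry g))
    (hcoc : ∀ σ τ υ, g σ τ + g (σ * τ) υ = g τ υ + g σ (τ * υ)) (hpg : ∀ σ τ, p • g σ τ = 0) :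
    ∃ b : absoluteGaloisGroup ℚ → AddCircle (1 : ℚ), IsLocallyConstant b ∧
      ∀ σ τ, g σ τ + b (σ * τ) = b σ + b τ := by
  refine twoCocycle_addCircle_prime_split_of_localGlobal ℚ hp ?_ ?_ ?_ g hg hcoc hpg
  · -- (i) `Ш²(ℚ, ℤ/pⁿ) = 0`
    intro n hn x hx
    haveI : NeZero (p ^ n) := ⟨(pow_pos hp.pos n).ne'⟩
    exact eq_zero_of_forall_localization_eq_zero_of_sha_mu_eq_bot h (p ^ n)
      (sha_mu_rat_eq_bot (p ^ n)) x hx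
  · -- (ii) finite support
    intro x
    haveI : NeZero p := ⟨hp.ne_zero⟩
    exact finite_setOf_localization_ne_zero h p x
  · -- (iii) the local theorems
    intro v
    rcases v with w | v
    · exact twoCocycle_addCircle_prime_split_absoluteGaloisGroup_completion_infinitePlace w
    · haveI : CharZero (v.adicCompletion ℚ) :=
        charZero_of_injective_algebraMap (algebraMap ℚ (v.adicCompletion ℚ)).injective
      exact twoCocycle_addCircle_prime_split_localField (v.adicCompletion ℚ) hp

/-- **Tate's theorem `H²(G_ℚ, ℚ/ℤ) = 0`, cochain form, from the Poitou–Tate fact**: every locally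
constant `2`-cocycle `Γ_ℚ × Γ_ℚ → ℚ/ℤ = AddCircle (1 : ℚ)` (trivial action) is the coboundary of a
locally constant cochain (Serre, Durham §6.1 Thm. 4 (Tate) for `K = ℚ`, in the form (6.5.1)
`H²(G_K, ℚ/ℤ) = 1`). [cite: SerreDurham1977, §6.1 Thm. 4 (Tate), §6.5 (6.5.1)]
[cite: Harari2020, Cor. 18.17] -/
theorem twoCocycle_addCircle_split_rat_of_poitouTate (h : poitouTate_sha_zmod_mu ℚ)
    (f : absoluteGaloisGroup ℚ → absoluteGaloisGroup ℚ → AddCircle (1 : ℚ))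
    (hf : IsLocallyConstant (Function.uncurry f))
    (hcoc : ∀ σ τ υ, f σ τ + f (σ * τ) υ = f τ υ + f σ (τ * υ)) :
    ∃ b : absoluteGaloisGroup ℚ → AddCircle (1 : ℚ), IsLocallyConstant b ∧
      ∀ σ τ, f σ τ + b (σ * τ) = b σ + b τ :=
  twoCocycle_addCircle_split_of_forall_prime
    (fun _ hp => twoCocycle_addCircle_prime_split_rat_of_poitouTate h hp) f hf hcoc

/-- **`Tate_projectiveLifting` from the Poitou–Tate fact** (Serre, Durham 1977, §6.1, Corollary
to Theorem 4 (Tate): every projective representation `G_ℚ → PGL_n(k)` with open kernel, `k`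
algebraically closed with the discrete topology, lifts to a continuous `G_ℚ → GL_n(k)`):
`Tate_projectiveLifting_of_H2_addCircle` (§6.1, "Theorem 4 ⟹ Corollary", proved in
`TateProjectiveLiftingH2Proofs.lean`) applied to `twoCocycle_addCircle_split_rat_of_poitouTate`
(Theorem 4 for `ℚ`).  The only named-fact input is `poitouTate_sha_zmod_mu ℚ` (Poitou–Tate duality
of `Ш¹(ℚ, μ_m)` and `Ш²(ℚ, ℤ/m)`, Harari Thm. 17.13 (b), Lemma 17.8).
[cite: SerreDurham1977, §6.1 Thm. 4 (Tate) and Corollary] [cite: Harari2020, Thm. 17.13 (b)] -/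
theorem Tate_projectiveLifting_of_poitouTate (h : poitouTate_sha_zmod_mu ℚ) :
    Tate_projectiveLifting :=
  Tate_projectiveLifting_of_H2_addCircle (twoCocycle_addCircle_split_rat_of_poitouTate h)

end Rat

end Literature.NumberTheory.GaloisRepresentations

end
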